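import Summits.CriticalPhenomena.PercolationContinuityZ3.Theorems.PercNearOneGluingNoHeavyQuantFarCycleBlockReach
import Summits.CriticalPhenomena.PercolationContinuityZ3.Theorems.PercNearOneGluingNoHeavyQuantFarDecLawDefs
import HarnessLib

/-!
# QUANT lane R8, front "FAR beyond trees", layer one — PENDANT CYCLE BLOCKS II: arcs, hub laws, independence bookkeeping, and THE TWO-CHAIN
# OF A PENDANT CYCLE (`Block.chainOf`), with `shift` = "unload the first listed hub" and its validity

builds on p205010 (kernel theorem, internal audit signed; external expert review pending)

Support file (`--supports stmt-CriticalPhenomena-4575`), seat `prim-quant-p1` (gen 22); memo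
`run/shared/lean/prim/quant/prim-quant-p1-g22/FOR-LEAD-KHUB.md` §2–§3.  Standard axioms; no sorries.

The law-level theorem `TwoChain.cycDec` (p1 g21, `…QuantFarDecLawCycDec`) speaks about a `TwoChain` (`…QuantFarDecLawDefs`): arm probabilities
`A i`, `B i` and hub laws `(z i, s i, d i)`.  Here we READ THIS DATA OFF A PENDANT CYCLE BLOCK (`Block.IsCycleBlock`, `…QuantFarCycleBlockReach`) and a
LIST `ps` of hub positions (in the applications: the loaded positions in increasing order):
* `Block.cwProb … p = ∏_{m<p} w(e_m) = P_w(CW p)`, `Block.ccwProb … p = ∏_{p ≤ m < L} w(e_m) = P_w(CCW p)` (`Block.real_CW`, `Block.real_CCW`), and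
  `P_w(RC p) = a + b − ab` (`Block.real_RC`: the two arcs use disjoint edge sets);
* hub laws `Block.hz/hs/hd … j = P_w(W_j = 0 / = 1 / ≥ 2)` (`W_j = Block.hubCount`);
* `Block.lpos L pre ps i` = the position of the `i`-th listed hub (`i = 0 ↦ pre`, beyond the list `↦ L`), and
  **`Block.chainOf … pre ps : TwoChain`** = `⟨cwProb ∘ lpos, ccwProb ∘ lpos, hz ∘ lpos, hs ∘ lpos, hd ∘ lpos⟩`;
  **`Block.chainOf_shift`**: `(chainOf … pre (p :: ps)).shift = chainOf … p ps` (removing hub 1 = dropping the head of the list, the cycle unchanged);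
  **`Block.chainOf_valid`**: for a non-decreasing list with `pre ≤ head` and entries `≤ L` the chain is `Valid ps.length`.
Bookkeeping for the later files: statistics READ OFF a set of pairs (`Block.ReadsOff`, a function-valued form of `DeterminedBy`), the edge sets of the
arcs (`Block.cwEdges/ccwEdges`), their disjointness from each other and from the hub pairs, distinct hubs' pair sets disjoint.
[cite: Grimmett1999, §1.3 p. 10; §2.2] (product measure, events determined by finitely many coordinates); bookkeeping [this work].
-/

noncomputable section

namespace Summit.CriticalPhenomena.PercolationContinuityZ3.Theorems

namespace Quant

namespace Block

open Finset MeasureTheory Set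
open Literature.Probability.LatticeModels
open Literature.Probability.Percolation
open Summit.CriticalPhenomena.PercolationContinuityZ3.Theorems.HairyCycle (cycE CW CCW RC)
open scoped Classical

variable {n : ℕ}

/-! ## Statistics read off a set of pairs -/

/-- A configuration statistic `f` is READ OFF the pair set `F` if configurations agreeing on `F` give the same value. [this work] -/
def ReadsOff {α : Sort*} (f : BondConfig (Fin n) → α) (F : Set (Sym2 (Fin n))) : Prop :=
  ∀ ω ω' : BondConfig (Fin n), ω ∩ F = ω' ∩ F → f ω = f ω'

/-- Enlarging the pair set. [this work] -/
theorem ReadsOff.mono {α : Sort*} {f : BondConfig (Fin n) → α} {F G : Set (Sym2 (Fin n))} (h : ReadsOff f F) (hFG : F ⊆ G) :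
    ReadsOff f G := by
  intro ω ω' hG
  apply h
  rw [← Set.inter_eq_right.2 hFG, ← Set.inter_assoc, hG, Set.inter_assoc]

/-- Post-composition. [this work] -/
theorem ReadsOff.map {α β : Sort*} {f : BondConfig (Fin n) → α} {F : Set (Sym2 (Fin n))} (hf : ReadsOff f F) (h : α → β) :
    ReadsOff (fun ω => h (f ω)) F := fun ω ω' hF => by
  show h (f ω) = h (f ω'); rw [hf ω ω' hF]

/-- Combining two statistics. [this work] -/
theorem ReadsOff.map₂ {α β γ : Sort*} {f : BondConfig (Fin n) → α} {g : BondConfig (Fin n) → β} {F G : Set (Sym2 (Fin n))}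
    (hf : ReadsOff f F) (hg : ReadsOff g G) (h : α → β → γ) : ReadsOff (fun ω => h (f ω) (g ω)) (F ∪ G) := fun ω ω' hFG => by
  show h (f ω) (g ω) = h (f ω') (g ω')
  rw [(hf.mono Set.subset_union_left) ω ω' hFG, (hg.mono Set.subset_union_right) ω ω' hFG]

/-- An event read off a statistic is determined by its pair set. [this work] -/
theorem ReadsOff.determinedBy {α : Sort*} {f : BondConfig (Fin n) → α} {F : Set (Sym2 (Fin n))} (hf : ReadsOff f F) (P : α → Prop) :
    DeterminedBy {ω : BondConfig (Fin n) | P (f ω)} F := by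
  rw [determinedBy_iff]
  intro ω ω' h
  simp only [mem_setOf_eq]
  rw [hf ω ω' h]

/-- "all pairs of `F` open" is read off `F`. [this work] -/
theorem readsOff_subset (F : Finset (Sym2 (Fin n))) : ReadsOff (fun ω : BondConfig (Fin n) => (↑F : Set (Sym2 (Fin n))) ⊆ ω) ↑F := by
  intro ω ω' h
  apply propext
  constructor
  · intro hs e he; exact ((Set.ext_iff.1 h e).1 ⟨hs he, he⟩).1
  · intro hs e he; exact ((Set.ext_iff.1 h e).2 ⟨hs he, he⟩).1

/-- "the pair `e` is open" is read off `{e}`. [this work] -/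
theorem readsOff_mem (e : Sym2 (Fin n)) : ReadsOff (fun ω : BondConfig (Fin n) => e ∈ ω) ↑({e} : Finset (Sym2 (Fin n))) := by
  have h := readsOff_subset ({e} : Finset (Sym2 (Fin n)))
  intro ω ω' hF
  have := h ω ω' hF
  simp only [Finset.coe_singleton, Set.singleton_subset_iff] at this
  exact this

/-- The loaded count of hub `j` is read off its hub pairs. [this work] -/
theorem readsOff_hubCount (cyc : ℕ → Fin n) (S : ℕ → Finset (Fin n)) (A : Finset (Fin n)) (j : ℕ) :
    ReadsOff (hubCount cyc S A j) ↑(hubPairs (S j) (cyc j)) := by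
  intro ω ω' h
  simp only [hubCount, inS_eq_inter, h]

/-! ## The arcs -/

/-- The edges of the clockwise arc to position `p`: `e_0, …, e_{p−1}`. [this work] -/
def cwEdges (L : ℕ) (cyc : ℕ → Fin n) (p : ℕ) : Finset (Sym2 (Fin n)) := (Finset.range p).image (cycE L cyc)

/-- The edges of the counter-clockwise arc to position `p`: `e_p, …, e_{L−1}`. [this work] -/
def ccwEdges (L : ℕ) (cyc : ℕ → Fin n) (p : ℕ) : Finset (Sym2 (Fin n)) := (Finset.Ico p L).image (cycE L cyc)

/-- `CW p` iff the clockwise edges are open. [this work] -/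
theorem CW_iff (L : ℕ) (cyc : ℕ → Fin n) (ω : BondConfig (Fin n)) (p : ℕ) : CW L cyc ω p ↔ (↑(cwEdges L cyc p) : Set (Sym2 (Fin n))) ⊆ ω := by
  constructor
  · intro h e he
    obtain ⟨m, hm, rfl⟩ := Finset.mem_image.1 (Finset.mem_coe.1 he)
    exact h m (Finset.mem_range.1 hm)
  · intro h m hm
    exact h (Finset.mem_coe.2 (Finset.mem_image_of_mem _ (Finset.mem_range.2 hm)))

/-- `CCW p` iff the counter-clockwise edges are open. [this work] -/
theorem CCW_iff (L : ℕ) (cyc : ℕ → Fin n) (ω : BondConfig (Fin n)) (p : ℕ) :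
    CCW L cyc ω p ↔ (↑(ccwEdges L cyc p) : Set (Sym2 (Fin n))) ⊆ ω := by
  constructor
  · intro h e he
    obtain ⟨m, hm, rfl⟩ := Finset.mem_image.1 (Finset.mem_coe.1 he)
    exact h m (Finset.mem_Ico.1 hm).1 (Finset.mem_Ico.1 hm).2
  · intro h m hm hmL
    exact h (Finset.mem_coe.2 (Finset.mem_image_of_mem _ (Finset.mem_Ico.2 ⟨hm, hmL⟩)))

/-- `CW p` is read off the clockwise edges. [this work] -/
theorem readsOff_CW (L : ℕ) (cyc : ℕ → Fin n) (p : ℕ) : ReadsOff (fun ω => CW L cyc ω p) ↑(cwEdges L cyc p) := by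
  intro ω ω' h
  have := readsOff_subset (cwEdges L cyc p) ω ω' h
  simp only [CW_iff]
  exact this

/-- `CCW p` is read off the counter-clockwise edges. [this work] -/
theorem readsOff_CCW (L : ℕ) (cyc : ℕ → Fin n) (p : ℕ) : ReadsOff (fun ω => CCW L cyc ω p) ↑(ccwEdges L cyc p) := by
  intro ω ω' h
  have := readsOff_subset (ccwEdges L cyc p) ω ω' h
  simp only [CCW_iff]
  exact this

/-- `CCW` is monotone in the position. [this work] -/
theorem CCW_mono {L : ℕ} {cyc : ℕ → Fin n} {ω : BondConfig (Fin n)} {p q : ℕ} (hpq : p ≤ q) (h : CCW L cyc ω p) : CCW L cyc ω q :=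
  fun m hm hmL => h m (le_trans hpq hm) hmL

/-- `CW` is antitone in the position. [this work] -/
theorem CW_anti {L : ℕ} {cyc : ℕ → Fin n} {ω : BondConfig (Fin n)} {p q : ℕ} (hpq : p ≤ q) (h : CW L cyc ω q) : CW L cyc ω p :=
  fun m hm => h m (lt_of_lt_of_le hm hpq)

/-- `CCW L` holds vacuously. [this work] -/
theorem CCW_top (L : ℕ) (cyc : ℕ → Fin n) (ω : BondConfig (Fin n)) : CCW L cyc ω L := fun _ hm hmL => absurd hmL (not_lt.2 hm)

/-- `P_w(CW p) = ∏_{m<p} w(e_m)`. [this work] -/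
def cwProb (L : ℕ) (cyc : ℕ → Fin n) (w : Sym2 (Fin n) → unitInterval) (p : ℕ) : ℝ := ∏ m ∈ Finset.range p, (w (cycE L cyc m) : ℝ)

/-- `P_w(CCW p) = ∏_{p ≤ m < L} w(e_m)`. [this work] -/
def ccwProb (L : ℕ) (cyc : ℕ → Fin n) (w : Sym2 (Fin n) → unitInterval) (p : ℕ) : ℝ := ∏ m ∈ Finset.Ico p L, (w (cycE L cyc m) : ℝ)

/-! ## Hub laws -/

/-- `P_w(W_j = 0)`. [this work] -/
def hz (cyc : ℕ → Fin n) (S : ℕ → Finset (Fin n)) (A : Finset (Fin n)) (w : Sym2 (Fin n) → unitInterval) (j : ℕ) : ℝ :=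
  (prodBernoulli w).real {ω | hubCount cyc S A j ω = 0}

/-- `P_w(W_j = 1)`. [this work] -/
def hs (cyc : ℕ → Fin n) (S : ℕ → Finset (Fin n)) (A : Finset (Fin n)) (w : Sym2 (Fin n) → unitInterval) (j : ℕ) : ℝ :=
  (prodBernoulli w).real {ω | hubCount cyc S A j ω = 1}

/-- `P_w(W_j ≥ 2)`. [this work] -/
def hd (cyc : ℕ → Fin n) (S : ℕ → Finset (Fin n)) (A : Finset (Fin n)) (w : Sym2 (Fin n) → unitInterval) (j : ℕ) : ℝ :=
  (prodBernoulli w).real {ω | 2 ≤ hubCount cyc S A j ω}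

/-- The hub law is a probability vector: `hz + hs + hd = 1`. [this work] -/
theorem hz_add_hs_add_hd (cyc : ℕ → Fin n) (S : ℕ → Finset (Fin n)) (A : Finset (Fin n)) (w : Sym2 (Fin n) → unitInterval) (j : ℕ) :
    hz cyc S A w j + hs cyc S A w j + hd cyc S A w j = 1 := by
  have hmeas : ∀ U : Set (BondConfig (Fin n)), MeasurableSet U := fun U => (Set.toFinite U).measurableSet
  unfold hz hs hd
  have h1 : {ω : BondConfig (Fin n) | hubCount cyc S A j ω = 0} ∪ {ω | hubCount cyc S A j ω = 1} = {ω | hubCount cyc S A j ω ≤ 1} := by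
    ext ω; simp only [Set.mem_union, mem_setOf_eq]; omega
  have hd1 : Disjoint {ω : BondConfig (Fin n) | hubCount cyc S A j ω = 0} {ω | hubCount cyc S A j ω = 1} := by
    rw [Set.disjoint_left]; intro ω h0 h1; simp only [mem_setOf_eq] at h0 h1; omega
  have h2 : {ω : BondConfig (Fin n) | 2 ≤ hubCount cyc S A j ω} = {ω | hubCount cyc S A j ω ≤ 1}ᶜ := by
    ext ω; simp only [Set.mem_compl_iff, mem_setOf_eq]; omega
  rw [← measureReal_union hd1 (hmeas _), h1, h2, probReal_compl_eq_one_sub (hmeas _)]; ring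

/-- `P_w(W_j ≥ 1) = hs + hd`. [this work] -/
theorem real_hubCount_ge_one (cyc : ℕ → Fin n) (S : ℕ → Finset (Fin n)) (A : Finset (Fin n)) (w : Sym2 (Fin n) → unitInterval) (j : ℕ) :
    (prodBernoulli w).real {ω | 1 ≤ hubCount cyc S A j ω} = hs cyc S A w j + hd cyc S A w j := by
  have hmeas : ∀ U : Set (BondConfig (Fin n)), MeasurableSet U := fun U => (Set.toFinite U).measurableSet
  unfold hs hd
  have h1 : {ω : BondConfig (Fin n) | hubCount cyc S A j ω = 1} ∪ {ω | 2 ≤ hubCount cyc S A j ω} = {ω | 1 ≤ hubCount cyc S A j ω} := by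
    ext ω; simp only [Set.mem_union, mem_setOf_eq]; omega
  have hd1 : Disjoint {ω : BondConfig (Fin n) | hubCount cyc S A j ω = 1} {ω | 2 ≤ hubCount cyc S A j ω} := by
    rw [Set.disjoint_left]; intro ω h0 h1; simp only [mem_setOf_eq] at h0 h1; omega
  rw [← measureReal_union hd1 (hmeas _), h1]

/-! ## The two-chain of a pendant cycle -/

/-- Position of the `i`-th listed hub (`i ≥ 1`); `i = 0 ↦ pre` (the position of an already removed hub, or `0`); beyond the list `↦ L`. [this work] -/
def lpos (L pre : ℕ) (ps : List ℕ) : ℕ → ℕ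
  | 0 => pre
  | i + 1 => ps.getD i L

/-- **The two-chain of a pendant cycle with listed hubs**: arms `A i = P(CW (lpos i))`, `B i = P(CCW (lpos i))`, hub laws of the listed hubs.
[this work] -/
def chainOf (L : ℕ) (cyc : ℕ → Fin n) (S : ℕ → Finset (Fin n)) (A : Finset (Fin n)) (w : Sym2 (Fin n) → unitInterval) (pre : ℕ) (ps : List ℕ) :
    TwoChain :=
  ⟨fun i => cwProb L cyc w (lpos L pre ps i), fun i => ccwProb L cyc w (lpos L pre ps i), fun i => hz cyc S A w (lpos L pre ps i),
    fun i => hs cyc S A w (lpos L pre ps i), fun i => hd cyc S A w (lpos L pre ps i)⟩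

/-- `lpos pre (p :: ps) (i+1) = lpos p ps i`. [this work] -/
@[simp] theorem lpos_cons_succ (L pre p : ℕ) (ps : List ℕ) (i : ℕ) : lpos L pre (p :: ps) (i + 1) = lpos L p ps i := by
  cases i with
  | zero => simp [lpos]
  | succ k => simp [lpos]

/-- `lpos pre ps 0 = pre`. [this work] -/
@[simp] theorem lpos_zero (L pre : ℕ) (ps : List ℕ) : lpos L pre ps 0 = pre := rfl

/-- `lpos pre (p :: ps) 1 = p`. [this work] -/
@[simp] theorem lpos_cons_one (L pre p : ℕ) (ps : List ℕ) : lpos L pre (p :: ps) 1 = p := by simp [lpos]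

/-- `lpos pre [] (i+1) = L`. [this work] -/
@[simp] theorem lpos_nil_succ (L pre i : ℕ) : lpos L pre [] (i + 1) = L := by simp [lpos]

/-- Beyond the list the position is `L`. [this work] -/
theorem lpos_of_length_lt {L pre : ℕ} {ps : List ℕ} {i : ℕ} (hi : ps.length < i) : lpos L pre ps i = L := by
  obtain ⟨k, rfl⟩ : ∃ k, i = k + 1 := ⟨i - 1, by omega⟩
  simp only [lpos]
  rw [List.getD_eq_getElem?_getD, List.getElem?_eq_none (by omega), Option.getD_none]

/-- Inside the list the position is the listed one. [this work] -/
theorem lpos_of_lt_length {L pre : ℕ} {ps : List ℕ} {i : ℕ} (hi : i < ps.length) : lpos L pre ps (i + 1) = ps[i] := by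
  simp only [lpos]
  rw [List.getD_eq_getElem?_getD, List.getElem?_eq_getElem hi, Option.getD_some]

/-- **Removing the first hub is dropping the head of the list**: `(chainOf pre (p :: ps)).shift = chainOf p ps`. [this work] -/
theorem chainOf_shift (L : ℕ) (cyc : ℕ → Fin n) (S : ℕ → Finset (Fin n)) (A : Finset (Fin n)) (w : Sym2 (Fin n) → unitInterval)
    (pre p : ℕ) (ps : List ℕ) : (chainOf L cyc S A w pre (p :: ps)).shift = chainOf L cyc S A w p ps := by
  simp only [TwoChain.shift, chainOf, lpos_cons_succ]

/-- A non-decreasing position function on all of `ℕ` from a sorted list with `pre ≤ head` and entries `≤ L`. [this work] -/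
theorem lpos_mono {L pre : ℕ} {ps : List ℕ} (hsort : ps.Pairwise (· < ·)) (hpre : ∀ p ∈ ps, pre ≤ p) (hL : ∀ p ∈ ps, p ≤ L) (hpreL : pre ≤ L)
    (i : ℕ) : lpos L pre ps i ≤ lpos L pre ps (i + 1) := by
  induction ps generalizing pre i with
  | nil =>
    cases i with
    | zero => simp [lpos]; exact hpreL
    | succ k => simp [lpos]
  | cons p ps ih =>
    cases i with
    | zero => simp [lpos]; exact hpre p (by simp)
    | succ k =>
      rw [lpos_cons_succ, lpos_cons_succ]
      rw [List.pairwise_cons] at hsort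
      exact ih hsort.2 (fun q hq => (hsort.1 q hq).le) (fun q hq => hL q (by simp [hq])) (hL p (by simp)) k

/-- Every position is `≤ L`. [this work] -/
theorem lpos_le {L pre : ℕ} {ps : List ℕ} (hL : ∀ p ∈ ps, p ≤ L) (hpreL : pre ≤ L) (i : ℕ) : lpos L pre ps i ≤ L := by
  cases i with
  | zero => exact hpreL
  | succ k =>
    simp only [lpos]
    rw [List.getD_eq_getElem?_getD]
    cases h : ps[k]? with
    | none => simp
    | some q => simp only [Option.getD_some]; exact hL q (List.mem_of_getElem? h)

section Probs

variable {L : ℕ} {cyc : ℕ → Fin n} {S : ℕ → Finset (Fin n)} {Z : Finset (Fin n)} (w : Sym2 (Fin n) → unitInterval)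

/-- `cwProb ∈ [0,1]`. [this work] -/
theorem cwProb_mem (p : ℕ) : 0 ≤ cwProb L cyc w p ∧ cwProb L cyc w p ≤ 1 :=
  ⟨Finset.prod_nonneg fun _ _ => (w _).2.1, Finset.prod_le_one (fun _ _ => (w _).2.1) fun _ _ => (w _).2.2⟩

/-- `ccwProb ∈ [0,1]`. [this work] -/
theorem ccwProb_mem (p : ℕ) : 0 ≤ ccwProb L cyc w p ∧ ccwProb L cyc w p ≤ 1 :=
  ⟨Finset.prod_nonneg fun _ _ => (w _).2.1, Finset.prod_le_one (fun _ _ => (w _).2.1) fun _ _ => (w _).2.2⟩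

/-- `cwProb` is antitone in the position. [this work] -/
theorem cwProb_anti {p q : ℕ} (hpq : p ≤ q) : cwProb L cyc w q ≤ cwProb L cyc w p :=
  Finset.prod_le_prod_of_subset_of_le_one (Finset.range_mono hpq) (fun _ _ => (w _).2.1) fun _ _ _ => (w _).2.2

/-- `ccwProb` is monotone in the position. [this work] -/
theorem ccwProb_mono {p q : ℕ} (hpq : p ≤ q) : ccwProb L cyc w p ≤ ccwProb L cyc w q :=
  Finset.prod_le_prod_of_subset_of_le_one (Finset.Ico_subset_Ico_left hpq) (fun _ _ => (w _).2.1) fun _ _ _ => (w _).2.2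

/-- `ccwProb L = 1`. [this work] -/
theorem ccwProb_top : ccwProb L cyc w L = 1 := by unfold ccwProb; rw [Finset.Ico_self, Finset.prod_empty]

variable (H : IsCycleBlock L cyc S Z)
include H

/-- **`P_w(CW p) = cwProb p`** (`p ≤ L`). [this work] -/
theorem real_CW {p : ℕ} (hp : p ≤ L) : (prodBernoulli w).real {ω | CW L cyc ω p} = cwProb L cyc w p := by
  have e : {ω : BondConfig (Fin n) | CW L cyc ω p} = {ω | (↑(cwEdges L cyc p) : Set (Sym2 (Fin n))) ⊆ ω} := by
    ext ω; exact CW_iff L cyc ω p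
  rw [e, prodBernoulli_real_subset, cwEdges, Finset.prod_image]
  · rfl
  · intro m hm m' hm' h
    exact cycE_inj H (lt_of_lt_of_le (Finset.mem_range.1 hm) hp) (lt_of_lt_of_le (Finset.mem_range.1 hm') hp) h

/-- **`P_w(CCW p) = ccwProb p`**. [this work] -/
theorem real_CCW (p : ℕ) : (prodBernoulli w).real {ω | CCW L cyc ω p} = ccwProb L cyc w p := by
  have e : {ω : BondConfig (Fin n) | CCW L cyc ω p} = {ω | (↑(ccwEdges L cyc p) : Set (Sym2 (Fin n))) ⊆ ω} := by
    ext ω; exact CCW_iff L cyc ω p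
  rw [e, prodBernoulli_real_subset, ccwEdges, Finset.prod_image]
  · rfl
  · intro m hm m' hm' h
    exact cycE_inj H (Finset.mem_Ico.1 hm).2 (Finset.mem_Ico.1 hm').2 h

/-- The two arcs to `p ≤ L` use disjoint edge sets. [this work] -/
theorem disjoint_cw_ccw {p : ℕ} (hp : p ≤ L) : Disjoint (cwEdges L cyc p) (ccwEdges L cyc p) := by
  rw [Finset.disjoint_left]
  intro e h1 h2
  obtain ⟨m, hm, rfl⟩ := Finset.mem_image.1 h1
  obtain ⟨m', hm', h⟩ := Finset.mem_image.1 h2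
  have := cycE_inj H (lt_of_lt_of_le (Finset.mem_range.1 hm) hp) (Finset.mem_Ico.1 hm').2 h.symm
  have h3 := Finset.mem_range.1 hm
  have h4 := (Finset.mem_Ico.1 hm').1
  omega

/-- **`P_w(RC p) = a + b − a·b`** with `a = cwProb p`, `b = ccwProb p` (`p ≤ L`). [this work] -/
theorem real_RC {p : ℕ} (hp : p ≤ L) :
    (prodBernoulli w).real {ω | RC L cyc ω p} = cwProb L cyc w p + ccwProb L cyc w p - cwProb L cyc w p * ccwProb L cyc w p := by
  have hmeas : ∀ U : Set (BondConfig (Fin n)), MeasurableSet U := fun U => (Set.toFinite U).measurableSet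
  have e : {ω : BondConfig (Fin n) | RC L cyc ω p} = {ω | CW L cyc ω p} ∪ {ω | CCW L cyc ω p} := by ext ω; rfl
  have hA : DeterminedBy {ω : BondConfig (Fin n) | CW L cyc ω p} (↑(cwEdges L cyc p) : Set (Sym2 (Fin n))) :=
    (readsOff_CW L cyc p).determinedBy id
  have hB : DeterminedBy {ω : BondConfig (Fin n) | CCW L cyc ω p} (↑(ccwEdges L cyc p) : Set (Sym2 (Fin n))) :=
    (readsOff_CCW L cyc p).determinedBy id
  have hint : (prodBernoulli w).real ({ω : BondConfig (Fin n) | CW L cyc ω p} ∩ {ω | CCW L cyc ω p}) =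
      cwProb L cyc w p * ccwProb L cyc w p := by
    rw [prodBernoulli_real_inter_of_determinedBy_disjoint w (disjoint_cw_ccw H hp) hA hB (hmeas _) (hmeas _),
      real_CW w H hp, real_CCW w H p]
  have hu := measureReal_union_add_inter (μ := prodBernoulli w) (s := {ω : BondConfig (Fin n) | CW L cyc ω p}) (hmeas {ω | CCW L cyc ω p})
  rw [hint, real_CW w H hp, real_CCW w H p] at hu
  rw [e]; linarith

/-! ## Disjointness of the coordinate sets -/

/-- A cycle edge is not a hub pair. [this work] -/
theorem cycE_notMem_hubPairs {m j : ℕ} (hm : m < L) (hj1 : 1 ≤ j) (hjL : j < L) : cycE L cyc m ∉ hubPairs (S j) (cyc j) := by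
  intro h
  obtain ⟨⟨z, hz, hze⟩, -⟩ := (Finset.mem_filter.1 h).2
  obtain ⟨i, hi, rfl⟩ := mem_cycE H hm hze
  exact H.cycS i j hi hj1 hjL hz

/-- The clockwise edges avoid every hub's pairs. [this work] -/
theorem disjoint_cwEdges_hubPairs {p j : ℕ} (hp : p ≤ L) (hj1 : 1 ≤ j) (hjL : j < L) : Disjoint (cwEdges L cyc p) (hubPairs (S j) (cyc j)) := by
  rw [Finset.disjoint_left]
  intro e he he'
  obtain ⟨m, hm, rfl⟩ := Finset.mem_image.1 he
  exact cycE_notMem_hubPairs H (lt_of_lt_of_le (Finset.mem_range.1 hm) hp) hj1 hjL he'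

/-- The counter-clockwise edges avoid every hub's pairs. [this work] -/
theorem disjoint_ccwEdges_hubPairs (p : ℕ) {j : ℕ} (hj1 : 1 ≤ j) (hjL : j < L) : Disjoint (ccwEdges L cyc p) (hubPairs (S j) (cyc j)) := by
  rw [Finset.disjoint_left]
  intro e he he'
  obtain ⟨m, hm, rfl⟩ := Finset.mem_image.1 he
  exact cycE_notMem_hubPairs H (Finset.mem_Ico.1 hm).2 hj1 hjL he'

/-- Distinct hubs have disjoint pair sets. [this work] -/
theorem disjoint_hubPairs {i j : ℕ} (hi1 : 1 ≤ i) (hiL : i < L) (hj1 : 1 ≤ j) (hjL : j < L) (hij : i ≠ j) :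
    Disjoint (hubPairs (S i) (cyc i)) (hubPairs (S j) (cyc j)) := by
  rw [Finset.disjoint_left]
  intro e h1 h2
  obtain ⟨-, hin⟩ := (Finset.mem_filter.1 h1).2
  obtain ⟨⟨z, hz, hze⟩, -⟩ := (Finset.mem_filter.1 h2).2
  rcases hin z hze with h | h
  · exact Finset.disjoint_left.1 (H.disj i j hi1 hiL hj1 hjL hij) h hz
  · exact H.cycS i j hiL hj1 hjL (h ▸ hz)

/-! ## Validity of the two-chain -/

omit H in
/-- **The two-chain of a pendant cycle is valid** for a strictly increasing list of positions `≤ L` with `pre ≤` every entry, `pre ≤ L`. [this work] -/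
theorem chainOf_valid (A : Finset (Fin n)) {pre : ℕ} {ps : List ℕ} (hsort : ps.Pairwise (· < ·)) (hpre : ∀ p ∈ ps, pre ≤ p)
    (hL : ∀ p ∈ ps, p ≤ L) (hpreL : pre ≤ L) : (chainOf L cyc S A w pre ps).Valid ps.length where
  A_nonneg i := (cwProb_mem w _).1
  A_le_one i := (cwProb_mem w _).2
  A_anti i := cwProb_anti w (lpos_mono hsort hpre hL hpreL i)
  B_nonneg i := (ccwProb_mem w _).1
  B_le_one i := (ccwProb_mem w _).2
  B_mono i := ccwProb_mono w (lpos_mono hsort hpre hL hpreL i)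
  B_top j hj := by
    show ccwProb L cyc w (lpos L pre ps j) = 1
    rw [lpos_of_length_lt (by omega), ccwProb_top w]
  z_nonneg i := measureReal_nonneg
  s_nonneg i := measureReal_nonneg
  d_nonneg i := measureReal_nonneg
  zsd i := hz_add_hs_add_hd cyc S A w _

end Probs

end Block

end Quant

end Summit.CriticalPhenomena.PercolationContinuityZ3.Theorems
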